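import Summits.BirchSwinnertonDyer.BirchSwinnertonDyer.Theorems.BiquadraticEisensteinDescentHeegnerTwistCouplingInSupplySylvesterCornerBT
import Literature.NumberTheory.QuadraticFields.HeegnerCondition
import Mathlib.FieldTheory.Finite.Basic
import HarnessLib

set_option linter.dupNamespace false -- `Summit.BirchSwinnertonDyer.BirchSwinnertonDyer.Theorems.…` (summit = sub, D-0017)
set_option autoImplicit false

/-!
# Crux `HeegnerTwistCouplingInSupply` (stmt-BirchSwinnertonDyer-21381) — the SYLVESTER `j = 0` corner, V:
# the LUCAS BRIDGE — `p ∤ Im((a + b√d)^{(p+1)/3})` ⟹ the unit `(a + b√d)/2` of `ℚ(√d)` is NOT a cube modulo the inert prime `p`;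
# hence the corner below `10⁵` modulo the `3`-descent hypothesis in the card's UNIT form and Burungale–Tian only

Route `BiquadraticEisensteinDescent` (cell `pub/bsd-wall`; width seat `bsd-wall-cm-bed-w4` g26; theorems only, `--supports` 21381,
helper). The corner files I–IV state the `3`-descent hypothesis `hDesc` with the non-cube condition on the unit `ε_{−3D}` in the
kernel-decidable LUCAS FORM. This file proves, for ANY quadratic field `L` with `d_L = d`, any prime `p ≠ 2`, `p ≡ 2 (mod 3)` with
`(d/p) = −1` (inert) and integers `a, b` with `a² − d b² = 4`: if `p ∤ Im((a + b√d)^{(p+1)/3})` (in `ℤ√d`) then `𝓞 L` has a unit that is not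
a cube modulo `p 𝓞 L` — namely `u = (a − bt)/2 + bω` for an integral basis `(1, ω)`, `ω² = m + tω`, `d = t² + 4m` (so `2u = a + bθ`,
`θ = 2ω − t = √d`). Proof: in the residue FIELD `F = 𝓞 L ⧸ 𝔓` (`𝔓 ⊇ (p)` maximal) of characteristic `p`, Euler's criterion gives
`θ̄^p = θ̄·d̄^{(p−1)/2} = −θ̄`, so the Frobenius is the conjugation on `F = 𝔽_p + 𝔽_p ω̄` and `z^{p²−1} = 1` on `F^×`; if `ū = x̄³` then
`(2ū)^{(p²−1)/3} = (2̄^{p−1})^{(p+1)/3} x̄^{p²−1} = 1`, i.e. `w = (a + bθ)^{(p+1)/3} = X + Yθ` has `w̄^p = w̄`, whence `X̄ − Ȳθ̄ = X̄ + Ȳθ̄`,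
`Ȳ = 0`, `p ∣ Y` — contradicting the Lucas certificate.

* §1 ★ `exists_unit_not_cube_of_lucas` — the bridge (a general fact about quadratic fields; `2` and every element of `𝔽_p` being a cube
  in `𝔽_{p²}` for `p ≡ 2 (mod 3)` is why the factor `2` and the norm-`4` normalisation are harmless).
* §2 ★ `desc_of_descUnit` — the card's L1-shaped hypothesis `hDescU` (non-cube stated as: for every quadratic `L` with `d_L = −3 d_K` there is
  a unit of `𝓞 L` that is not a cube modulo `p`) IMPLIES the Lucas-form hypothesis `hDesc` of files I–IV;
  ★★ `cruxOnSylvesterCorner_of_descUnit_BT_lt5` — EVERY prime `p ≡ 8 (mod 9)` below `10⁵`: the conclusion of crux 21381 at `(W_p, p)`,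
  modulo `hDescU` and Burungale–Tian ONLY.

HONEST FRAMING: corner layer on one CM family; the `3`-isogeny descent (`hDescU`, card `splitting-bias` L1 with the card's own unit
condition) is NOT formalised and stays a hypothesis; nothing here proves the crux or BSD. No definition, no named fact, no `sorry`; axioms
standard. [cite: Marcus2018, Ch. 2 Thm. 1; Ch. 3 Thm. 25] [cite: IrelandRosen1990, Prop. 5.1.2 and Prop. 9.1.4] [cite: CohenPazuki2009, §2]
[cite: BurungaleTian2026, Thm. 1.1]
-/

noncomputable section

open scoped Classical NumberField

namespace Summit.BirchSwinnertonDyer.BirchSwinnertonDyer.Theorems.SylvesterCorner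

open _root_.WeierstrassCurve Literature.NumberTheory.EllipticCurves
open Module NumberField Literature.NumberTheory.QuadraticFields.Quadratic

/-! ## §1 The Lucas bridge -/

section Bridge

variable {L : Type} [Field L] [NumberField L]

/-- Parity step: `a² − (t² + 4m) b² = 4` forces `a ≡ bt (mod 2)`. [folklore] -/
theorem even_sub_mul_of_sq_sub {a b t m : ℤ} (hab : a ^ 2 - (t ^ 2 + 4 * m) * b ^ 2 = 4) : Even (a - b * t) := by
  by_contra hodd
  rw [Int.not_even_iff_odd] at hodd
  have hodd' : Odd (a + b * t) := by
    have : a + b * t = (a - b * t) + 2 * (b * t) := by ring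
    rw [this]
    exact hodd.add_even (even_two_mul _)
  have hprod : Odd ((a - b * t) * (a + b * t)) := hodd.mul hodd'
  have heven : Even ((a - b * t) * (a + b * t)) := ⟨2 * (1 + m * b ^ 2), by linear_combination hab⟩
  exact (Int.not_odd_iff_even.mpr heven) hprod

/-- ★ **The Lucas bridge.** Let `L` be a quadratic field with `d_L = d`, `p ≠ 2` a prime with `p ≡ 2 (mod 3)` and `(d/p) = −1` (so `p` is
inert in `L`), and `a, b ∈ ℤ` with `a² − d b² = 4` (so `(a + b√d)/2` is a norm-one unit of `𝓞 L`). If `p ∤ Im((a + b√d)^{(p+1)/3})`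
(computed in `ℤ√d`), then some unit of `𝓞 L` is NOT a cube modulo `p 𝓞 L`. (Frobenius = conjugation on `𝓞 L/𝔓 ≅ 𝔽_{p²}`; a cube
`ū = x̄³` has `ū^{(p²−1)/3} = 1`; `2` and `𝔽_p^×` consist of cubes as `3 ∤ p − 1`.) [cite: Marcus2018, Ch. 2 Thm. 1; Ch. 3 Thm. 25]
[cite: IrelandRosen1990, Prop. 5.1.2 and Prop. 9.1.4] -/
theorem exists_unit_not_cube_of_lucas (h2 : finrank ℚ L = 2) {d : ℤ} (hdL : NumberField.discr L = d)
    {p : ℕ} (hp : p.Prime) (hp2 : p ≠ 2) (hp3 : p % 3 = 2) (hJ : jacobiSym d p = -1)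
    {a b : ℤ} (hab : a ^ 2 - d * b ^ 2 = 4)
    (hL : ¬ (p : ℤ) ∣ ((⟨a, b⟩ : ℤ√d) ^ ((p + 1) / 3)).im) :
    ∃ u : (𝓞 L)ˣ, ∀ x : 𝓞 L, (u : 𝓞 L) - x ^ 3 ∉ Ideal.span {(p : 𝓞 L)} := by
  haveI : Fact p.Prime := ⟨hp⟩
  -- integral basis `(1, ω)`, `ω² = m + tω`, `d = t² + 4m`, `θ = 2ω − t`, `θ² = d`
  obtain ⟨bs, hbs⟩ := exists_basis_zero_eq_one h2
  have hωω : bs 1 * bs 1 = (bs.repr (bs 1 * bs 1) 0 : 𝓞 L) + (bs.repr (bs 1 * bs 1) 1 : 𝓞 L) * bs 1 :=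
    basis_one_mul_self_eq bs hbs
  have hd : d = (bs.repr (bs 1 * bs 1) 1) ^ 2 + 4 * bs.repr (bs 1 * bs 1) 0 := by
    rw [← hdL]; exact discr_eq_sq_add_four_mul bs hbs
  generalize bs.repr (bs 1 * bs 1) 0 = m at hωω hd
  generalize bs.repr (bs 1 * bs 1) 1 = t at hωω hd
  set ω : 𝓞 L := bs 1 with hω_def
  have hrepr : ∀ x : 𝓞 L, x = (bs.repr x 0 : 𝓞 L) + (bs.repr x 1 : 𝓞 L) * ω := fun x => by
    conv_lhs => rw [← bs.sum_repr x]
    rw [Fin.sum_univ_two, hbs, zsmul_eq_mul, mul_one, zsmul_eq_mul]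
  set θ : 𝓞 L := 2 * ω - (t : 𝓞 L) with hθ_def
  have hθθ : θ * θ = (d : 𝓞 L) := by
    rw [hd]; push_cast
    linear_combination (4 : 𝓞 L) * hωω
  -- the unit `u = c + bω`, `2u = a + bθ`
  obtain ⟨c, hc⟩ := even_sub_mul_of_sq_sub (hd ▸ hab)
  have hcc : c * (c + b * t) - m * b ^ 2 = 1 := by
    have h4 : (4 : ℤ) * (c * (c + b * t) - m * b ^ 2) = 4 * 1 := by
      have hab' := hd ▸ hab
      linear_combination hab' - (a + 2 * c + b * t) * hc
    exact mul_left_cancel₀ (by norm_num) h4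
  have hcc' : ((c : 𝓞 L) * (c + b * t) - m * b ^ 2 : 𝓞 L) = 1 := by exact_mod_cast congrArg (Int.cast : ℤ → 𝓞 L) hcc
  have huv : ((c : 𝓞 L) + (b : 𝓞 L) * ω) * (((c : 𝓞 L) + (b : 𝓞 L) * t) - (b : 𝓞 L) * ω) = 1 := by
    linear_combination hcc' - (b : 𝓞 L) ^ 2 * hωω
  let u : (𝓞 L)ˣ := ⟨(c : 𝓞 L) + (b : 𝓞 L) * ω, ((c : 𝓞 L) + (b : 𝓞 L) * t) - (b : 𝓞 L) * ω, huv, by rw [mul_comm]; exact huv⟩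
  have h2u : (a : 𝓞 L) + (b : 𝓞 L) * θ = 2 * (u : 𝓞 L) := by
    have hc' : ((a : ℤ) : 𝓞 L) = 2 * c + b * t := by
      have : a = 2 * c + b * t := by linarith [hc]
      rw [this]; push_cast; ring
    show (a : 𝓞 L) + (b : 𝓞 L) * θ = 2 * ((c : 𝓞 L) + (b : 𝓞 L) * ω)
    rw [hc', hθ_def]; ring
  refine ⟨u, fun x hx => hL ?_⟩
  -- a maximal `𝔓 ⊇ (p)`; the residue field `F = 𝓞 L ⧸ 𝔓` has characteristic `p`
  have hne : Ideal.span {(p : 𝓞 L)} ≠ ⊤ := by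
    rw [Ne, Ideal.span_singleton_eq_top]
    intro hunit
    have hu' : IsUnit ((p : ℤ) : 𝓞 L) := by simpa using hunit
    have := isUnit_of_isUnit_intCast (K := L) hu'
    rw [Int.isUnit_iff] at this
    have h2le := hp.two_le
    omega
  obtain ⟨P, hPmax, hle⟩ := Ideal.exists_le_maximal _ hne
  letI : Field (𝓞 L ⧸ P) := Ideal.Quotient.field P
  set ψ : 𝓞 L →+* 𝓞 L ⧸ P := Ideal.Quotient.mk P with hψ
  have hψp : (p : 𝓞 L ⧸ P) = 0 := by
    rw [← map_natCast ψ p, hψ, Ideal.Quotient.eq_zero_iff_mem]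
    exact hle (Ideal.mem_span_singleton_self _)
  haveI hchar : CharP (𝓞 L ⧸ P) p := (CharP.charP_iff_prime_eq_zero hp).mpr hψp
  haveI : ExpChar (𝓞 L ⧸ P) p := ExpChar.prime hp
  -- notation-free abbreviations in `F`
  set Θ : 𝓞 L ⧸ P := ψ θ with hΘ
  set Ω : 𝓞 L ⧸ P := ψ ω with hΩ
  have hΘΘ : Θ * Θ = (d : 𝓞 L ⧸ P) := by rw [hΘ, ← map_mul, hθθ, map_intCast]
  have h2Ω : (2 : 𝓞 L ⧸ P) * Ω = Θ + (t : 𝓞 L ⧸ P) := by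
    rw [hΘ, hΩ, hθ_def, map_sub, map_mul, map_intCast, map_ofNat]; ring
  -- `p ∤ d`, `(d : F) ≠ 0`, `(2 : F) ≠ 0`
  have hpd : ¬ (p : ℤ) ∣ d := by
    intro hdvd
    have h0 : jacobiSym d p = 0 := by
      rw [jacobiSym.mod_left, Int.emod_eq_zero_of_dvd hdvd, jacobiSym.zero_left hp.one_lt]
    rw [h0] at hJ; norm_num at hJ
  have hdF : (d : 𝓞 L ⧸ P) ≠ 0 := by rwa [Ne, CharP.intCast_eq_zero_iff (𝓞 L ⧸ P) p]
  have h2F : (2 : 𝓞 L ⧸ P) ≠ 0 := by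
    intro h
    have : ((2 : ℕ) : 𝓞 L ⧸ P) = 0 := by exact_mod_cast h
    rw [CharP.cast_eq_zero_iff (𝓞 L ⧸ P) p] at this
    have := (Nat.prime_dvd_prime_iff_eq hp Nat.prime_two).mp this
    exact hp2 this
  have hΘ0 : Θ ≠ 0 := fun h => hdF (by rw [← hΘΘ, h, mul_zero])
  -- Euler: `d^{(p−1)/2} = −1` in `F`, hence `Θ^p = −Θ`
  have hodd : p % 2 = 1 := Nat.odd_iff.mp (hp.odd_of_ne_two hp2)
  have hEul : (d : 𝓞 L ⧸ P) ^ (p / 2) = -1 := by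
    have hleg : legendreSym p d = -1 := by rw [jacobiSym.legendreSym.to_jacobiSym]; exact hJ
    have hz : (d : ZMod p) ^ (p / 2) = -1 := by
      have := legendreSym.eq_pow p d
      rw [hleg] at this
      push_cast at this
      exact this.symm
    have := congrArg (ZMod.castHom (dvd_refl p) (𝓞 L ⧸ P)) hz
    simpa using this
  have hFrobΘ : Θ ^ p = -Θ := by
    have hp' : p = 2 * (p / 2) + 1 := by omega
    conv_lhs => rw [hp']
    rw [pow_succ, pow_mul, sq, hΘΘ, hEul]; ring
  -- integer casts are Frobenius-fixed
  have hFrobInt : ∀ z : ℤ, ((z : 𝓞 L ⧸ P)) ^ p = (z : 𝓞 L ⧸ P) := fun z => by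
    have h := congrArg (ZMod.castHom (dvd_refl p) (𝓞 L ⧸ P)) (ZMod.pow_card (z : ZMod p))
    rw [map_pow, map_intCast] at h
    exact h
  -- Frobenius of `Ω` and of every element: `z^{p²} = z`
  have hFrobΩ2 : (Ω ^ p) ^ p = Ω := by
    have h1 : ((2 : 𝓞 L ⧸ P) * Ω) ^ p = -Θ + (t : 𝓞 L ⧸ P) := by
      rw [h2Ω, add_pow_expChar, hFrobΘ, hFrobInt]
    have h2p : ((2 : 𝓞 L ⧸ P)) ^ p = 2 := by exact_mod_cast hFrobInt 2
    have h1' : (2 : 𝓞 L ⧸ P) * Ω ^ p = -Θ + (t : 𝓞 L ⧸ P) := by rw [← h2p, ← mul_pow, h1]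
    have h3 : ((2 : 𝓞 L ⧸ P) * Ω ^ p) ^ p = Θ + (t : 𝓞 L ⧸ P) := by
      rw [h1', add_pow_expChar, neg_pow, hFrobΘ, hFrobInt, Odd.neg_one_pow (hp.odd_of_ne_two hp2)]
      ring
    rw [mul_pow, h2p, ← h2Ω] at h3
    exact mul_left_cancel₀ h2F h3
  have hFrobAll : ∀ z : 𝓞 L ⧸ P, (z ^ p) ^ p = z := by
    intro z
    obtain ⟨x, rfl⟩ := Ideal.Quotient.mk_surjective z
    rw [hrepr x, map_add, map_mul, map_intCast, map_intCast, add_pow_expChar, add_pow_expChar, mul_pow, mul_pow,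
      hFrobInt, hFrobInt, hFrobInt, hFrobInt]
    show (bs.repr x 0 : 𝓞 L ⧸ P) + (bs.repr x 1 : 𝓞 L ⧸ P) * (ψ ω ^ p) ^ p = _
    rw [← hΩ, hFrobΩ2]
  have hpowsub : ∀ z : 𝓞 L ⧸ P, z ≠ 0 → z ^ (p * p - 1) = 1 := by
    intro z hz
    have h := hFrobAll z
    rw [← pow_mul] at h
    have hsplit : z ^ (p * p) = z ^ (p * p - 1) * z := by
      rw [← pow_succ]; congr 1; have := hp.one_lt; have : 1 ≤ p * p := Nat.one_le_iff_ne_zero.mpr (by positivity); omega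
    rw [hsplit] at h
    exact mul_right_cancel₀ hz (by rw [h, one_mul])
  -- the cube hypothesis in `F`
  have hux : ψ (u : 𝓞 L) = ψ x ^ 3 := by
    have : ψ ((u : 𝓞 L) - x ^ 3) = 0 := (Ideal.Quotient.eq_zero_iff_mem).mpr (hle hx)
    rwa [map_sub, map_pow, sub_eq_zero] at this
  have huF : ψ (u : 𝓞 L) ≠ 0 := (u.isUnit.map ψ).ne_zero
  have hxF : ψ x ≠ 0 := fun h => huF (by rw [hux, h]; ring)
  -- `z = a + bΘ = 2ū`; `z^{(p²−1)/3} = 1`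
  set n : ℕ := (p + 1) / 3 with hn
  have h3n : 3 * n = p + 1 := by omega
  have hz1 : (ψ ((a : 𝓞 L) + (b : 𝓞 L) * θ)) ^ (n * (p - 1)) = 1 := by
    rw [h2u, map_mul, map_ofNat, hux, mul_pow, ← pow_mul]
    have h2pm : ((2 : 𝓞 L ⧸ P)) ^ (n * (p - 1)) = 1 := by
      rw [mul_comm, pow_mul]
      have h2p1 : (2 : 𝓞 L ⧸ P) ^ (p - 1) = 1 := by
        have h : (2 : 𝓞 L ⧸ P) ^ p = 2 := by exact_mod_cast hFrobInt 2
        have hsplit : (2 : 𝓞 L ⧸ P) ^ p = 2 ^ (p - 1) * 2 := by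
          rw [← pow_succ]; congr 1; have := hp.one_lt; omega
        rw [hsplit] at h
        exact mul_right_cancel₀ h2F (by rw [h, one_mul])
      rw [h2p1, one_pow]
    have hx1 : ψ x ^ (3 * (n * (p - 1))) = 1 := by
      have : 3 * (n * (p - 1)) = p * p - 1 := by
        rw [← mul_assoc, h3n]
        have := hp.one_lt
        zify [this.le, Nat.one_le_iff_ne_zero.mpr (show p * p ≠ 0 by positivity)]
        ring
      rw [this]; exact hpowsub _ hxF
    rw [h2pm, hx1, one_mul]
  -- `w = (a + bθ)^n = X + Yθ` via `ℤ√d → 𝓞 L`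
  set φ : ℤ√d →+* 𝓞 L := Zsqrtd.lift ⟨θ, hθθ⟩ with hφ
  have hφab : φ ⟨a, b⟩ = (a : 𝓞 L) + (b : 𝓞 L) * θ := by simp [hφ]
  set W : ℤ√d := (⟨a, b⟩ : ℤ√d) ^ n with hW
  have hφW : φ W = (W.re : 𝓞 L) + (W.im : 𝓞 L) * θ := by simp [hφ]
  have hwpow : (ψ (φ W)) ^ (p - 1) = 1 := by
    rw [hW, map_pow, map_pow, hφab, ← pow_mul]; exact hz1
  have hw : ψ (φ W) = (W.re : 𝓞 L ⧸ P) + (W.im : 𝓞 L ⧸ P) * Θ := by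
    rw [hφW, map_add, map_mul, map_intCast, map_intCast]
  -- `w^p = w` and Frobenius: `X − YΘ = X + YΘ`
  have hwp : (ψ (φ W)) ^ p = ψ (φ W) := by
    have hsplit : (ψ (φ W)) ^ p = (ψ (φ W)) ^ (p - 1) * ψ (φ W) := by
      rw [← pow_succ]; congr 1; have := hp.one_lt; omega
    rw [hsplit, hwpow, one_mul]
  rw [hw, add_pow_expChar, mul_pow, hFrobInt, hFrobInt, hFrobΘ] at hwp
  -- `2·Y·Θ = 0`
  have hY : ((W.im : 𝓞 L ⧸ P)) * (2 * Θ) = 0 := by linear_combination -hwp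
  rcases mul_eq_zero.mp hY with hY0 | h20
  · exact (CharP.intCast_eq_zero_iff (𝓞 L ⧸ P) p _).mp hY0
  · exact absurd (mul_eq_zero.mp h20) (not_or.mpr ⟨h2F, hΘ0⟩)

end Bridge

/-! ## §2 The card's unit form of the descent hypothesis implies the Lucas form -/

section UnitForm

/-- `(−3/p) = −1` for an odd `p ≡ 2 (mod 3)` (`J(−3|p)·J(p|3) = J(9|p) = 1` and `J(p|3) = J(2|3) = −1`).
[cite: IrelandRosen1990, Prop. 5.1.2] -/
theorem jacobiSym_neg_three_eq_neg_one {p : ℕ} (hp : Odd p) (hp3 : p % 3 = 2) : jacobiSym (-3) p = -1 := by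
  have hJ3 : jacobiSym (p : ℤ) 3 = -1 := by
    rw [jacobiSym.mod_left, show (p : ℤ) % ((3 : ℕ) : ℤ) = 2 by omega, jacobiSym.at_two (by decide : Odd 3)]
    decide
  have hg : (3 : ℤ).gcd p = 1 := by
    rw [Int.gcd_eq_natAbs, Int.natAbs_natCast]
    show Nat.gcd 3 p = 1
    exact Nat.Coprime.gcd_eq_one ((Nat.Prime.coprime_iff_not_dvd Nat.prime_three).mpr (by omega))
  have key : jacobiSym (-3) p * jacobiSym (p : ℤ) 3 = jacobiSym (3 * (3 : ℕ)) p := by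
    rw [jacobiSym.neg _ hp, jacobiSym.mul_left]
    rcases Nat.odd_mod_four_iff.mp (Nat.odd_iff.mp hp) with h1 | h3
    · rw [ZMod.χ₄_nat_one_mod_four h1, one_mul, jacobiSym.quadratic_reciprocity_one_mod_four' (by decide : Odd 3) h1]
    · rw [ZMod.χ₄_nat_three_mod_four h3, jacobiSym.quadratic_reciprocity_three_mod_four (by decide : 3 % 4 = 3) h3]
      ring
  rw [hJ3, show (3 : ℤ) * (3 : ℕ) = 3 ^ 2 by norm_num, jacobiSym.sq_one' hg] at key
  linarith

/-- ★ **Unit form ⟹ Lucas form.** The `3`-descent hypothesis with the non-cube condition stated as in card `splitting-bias` L1 —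
«for every quadratic field `L` with `d_L = −3 d_K` some unit of `𝓞 L` is not a cube modulo `p 𝓞 L`» — implies the Lucas-form
hypothesis `hDesc` of `…SylvesterCorner` (by `exists_unit_not_cube_of_lucas`, `(−3d_K/p) = (−3/p)(d_K/p) = −1`).
[cite: CohenPazuki2009, §2] [cite: Marcus2018, Ch. 3 Thm. 25] -/
theorem desc_of_descUnit
    (hDescU : ∀ (p : ℕ) (K : Type) [Field K] [NumberField K], p.Prime → p % 9 = 8 →
      IsImaginaryQuadratic K → 4 < (NumberField.discr K).natAbs →
      jacobiSym (NumberField.discr K) 3 = 1 → jacobiSym (NumberField.discr K) p = 1 →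
      ¬ 3 ∣ NumberField.classNumber K →
      (∀ (L : Type) [Field L] [NumberField L], Module.finrank ℚ L = 2 →
        NumberField.discr L = -3 * NumberField.discr K →
        ∃ u : (𝓞 L)ˣ, ∀ x : 𝓞 L, (u : 𝓞 L) - x ^ 3 ∉ Ideal.span {(p : 𝓞 L)}) →
      ((⟨0, 0, (p : ℚ), 0, 0⟩ : WeierstrassCurve ℚ).quadraticTwist (NumberField.discr K : ℚ)).mordellWeilRank = 0 ∧
      ∀ c ∈ ((⟨0, 0, (p : ℚ), 0, 0⟩ : WeierstrassCurve ℚ).quadraticTwist (NumberField.discr K : ℚ)).sha,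
        3 • c = 0 → c = 0) :
    ∀ (p : ℕ) (K : Type) [Field K] [NumberField K] (M a b : ℤ), p.Prime → p % 9 = 8 →
      IsImaginaryQuadratic K → 4 < (NumberField.discr K).natAbs →
      jacobiSym (NumberField.discr K) 3 = 1 → jacobiSym (NumberField.discr K) p = 1 →
      ¬ 3 ∣ NumberField.classNumber K → M = -3 * NumberField.discr K → a ^ 2 - M * b ^ 2 = 4 →
      ¬ (p : ℤ) ∣ ((⟨a, b⟩ : ℤ√M) ^ ((p + 1) / 3)).im →
      ((⟨0, 0, (p : ℚ), 0, 0⟩ : WeierstrassCurve ℚ).quadraticTwist (NumberField.discr K : ℚ)).mordellWeilRank = 0 ∧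
      ∀ c ∈ ((⟨0, 0, (p : ℚ), 0, 0⟩ : WeierstrassCurve ℚ).quadraticTwist (NumberField.discr K : ℚ)).sha,
        3 • c = 0 → c = 0 := by
  intro p K _ _ M a b hp hp9 hK hd4 hJ3 hJp hh3 hM hab hL
  refine hDescU p K hp hp9 hK hd4 hJ3 hJp hh3 fun L _ _ h2L hdL => ?_
  have hp2 : p ≠ 2 := by rintro rfl; omega
  have hJM : jacobiSym M p = -1 := by
    rw [hM, jacobiSym.mul_left, jacobiSym_neg_three_eq_neg_one (hp.odd_of_ne_two hp2) (by omega), hJp]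
    norm_num
  exact exists_unit_not_cube_of_lucas h2L (hdL.trans hM.symm) hp hp2 (by omega) hJM hab hL

/-- ★★ **The Sylvester corner below `10⁵`, modulo the `3`-descent hypothesis in the card's UNIT form and Burungale–Tian ONLY.**
For every prime `p ≡ 8 (mod 9)` with `p < 10⁵`: a Heegner field `K′ = ℚ(√D)` of `N(W_p)`, `W_p : y² + p·y = x³`, with `4 < |d_{K′}|`,
`L(W_p^{(d_{K′})}, 1) ≠ 0`, `h(K′) < p`, `p ∤ h(K′)` — the conclusion of `HeegnerTwistCouplingInSupply` at `(W_p, p)`.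
[cite: CohenPazuki2009, §2] [cite: BurungaleTian2026, Thm. 1.1] [cite: SilvermanATAEC1994, Ch. II Cor. 10.5.1] -/
theorem cruxOnSylvesterCorner_of_descUnit_BT_lt5
    (hDescU : ∀ (p : ℕ) (K : Type) [Field K] [NumberField K], p.Prime → p % 9 = 8 →
      IsImaginaryQuadratic K → 4 < (NumberField.discr K).natAbs →
      jacobiSym (NumberField.discr K) 3 = 1 → jacobiSym (NumberField.discr K) p = 1 →
      ¬ 3 ∣ NumberField.classNumber K →
      (∀ (L : Type) [Field L] [NumberField L], Module.finrank ℚ L = 2 →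
        NumberField.discr L = -3 * NumberField.discr K →
        ∃ u : (𝓞 L)ˣ, ∀ x : 𝓞 L, (u : 𝓞 L) - x ^ 3 ∉ Ideal.span {(p : 𝓞 L)}) →
      ((⟨0, 0, (p : ℚ), 0, 0⟩ : WeierstrassCurve ℚ).quadraticTwist (NumberField.discr K : ℚ)).mordellWeilRank = 0 ∧
      ∀ c ∈ ((⟨0, 0, (p : ℚ), 0, 0⟩ : WeierstrassCurve ℚ).quadraticTwist (NumberField.discr K : ℚ)).sha,
        3 • c = 0 → c = 0)
    (hBT : burungaleTian_analyticRank_eq_zero_of_selmerCorank_eq_zero_of_hasCM) :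
    ∀ (p : ℕ) [Fact p.Prime] [(⟨0, 0, (p : ℚ), 0, 0⟩ : WeierstrassCurve ℚ).IsElliptic]
      [(⟨0, 0, (p : ℚ), 0, 0⟩ : WeierstrassCurve ℚ).IsGloballyMinimal]
      [NeZero ((⟨0, 0, (p : ℚ), 0, 0⟩ : WeierstrassCurve ℚ).conductorNorm ℤ)],
      p % 9 = 8 → p < 100000 →
      ∃ (K : Type) (_ : Field K) (_ : NumberField K),
        IsImaginaryQuadratic K ∧ 4 < (NumberField.discr K).natAbs ∧
        SatisfiesHeegnerHypothesis ((⟨0, 0, (p : ℚ), 0, 0⟩ : WeierstrassCurve ℚ).conductorNorm ℤ) K ∧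
        ((⟨0, 0, (p : ℚ), 0, 0⟩ : WeierstrassCurve ℚ).quadraticTwist (NumberField.discr K : ℚ)).entireLFunction 1 ≠ 0 ∧
        NumberField.classNumber K < p ∧ ¬ p ∣ NumberField.classNumber K :=
  cruxOnSylvesterCorner_of_desc_BT_lt5 (desc_of_descUnit hDescU) hBT

end UnitForm

end Summit.BirchSwinnertonDyer.BirchSwinnertonDyer.Theorems.SylvesterCorner
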